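import Summits.QuantumFields.QCD.Theses.EulerDescent
import Summits.QuantumFields.QCD.Theorems.RayDescent.Negative.TrivialSlices
import Summits.QuantumFields.QCD.Theorems.RayDescent.Negative.CornerPinLoadBearing
import Summits.QuantumFields.QCD.Theorems.RayDescent.Negative.ConeMembershipUpwardLaw

/-!
# Disproof of `RayDescent` (stmt-QuantumFields-16900) — findings, cycle 1 (cdisprove, 2026-08-17)

Crux: `Summit.QuantumFields.QCD.Theses.EulerDescent.RayDescent` (route `EulerDescent`, rank 2).
Picked line: `Sketch` (half-plane Harnack; stubs (H) `stub_harnackConeChord` LANDED p166243,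
(M) `stub_harnackConeMembership` open, (B) `stub_repinInvariance` open).

VERDICT OF THE CYCLE: **no kill**. Index of findings (kernel-checked unless marked PAPER / SORRY):

* §1 WHY IT RESISTS. Every hypothesis-discharging instance of the crux needs `IsLUB` of the set of
  non-massive degenerate bare masses of HONEST lattice QCD at `β_k` (phase-structure content nobody
  can certify), and a refutation needs in addition certified NON-decay of an honest connected
  correlator eventually in `k`. At `N_f = 0` the corner is unsatisfiable (vacuous slice,
  `Negative/TrivialSlices.lean`, g1). So no unconditional `¬ RayDescent` (nor `RayDescent`) is
  writable in the present tree; the difficulty tag `open-problem` is literal. PAPER: the physical law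
  "Euler share `d log Δ/d log m ≤ 1` of the LIGHTEST state" passes every regime we can compute —
  GMOR `1/2`; heavy degenerate glueball `2N_f/33`; heavy-light `m_Q + Λ̄` (`∂_Λ > 0`); mass-deformed
  Banks–Zaks window `1/(1+γ*) < 1` and `1 − β₀^{(N_f)}/β₀^{(k)}` after partial decoupling (share → 1⁻
  as `γ* → 0`: the constant `1` is TIGHT over all `N_f`, not for `N_f = 2, 3` where the sup is ≈ 0.75);
  quarkonium `1 − (γ₀/β₀-term)/log(m²/Λ²) < 1` in RGI units (the statement's `m` IS RGI:
  `Z_m ≍ (log a⁻²)^{γ₀/2β₀}`), `> 1` only in pole-mass units and never lightest; β = 0 Kawamoto–Smit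
  pion share ≤ 1/2 (g1, census). Data: `M_PS/m_q^{RGI}` is monotone decreasing in every simulation
  (share > 1 would need `M_PS²/m_q²` INCREASING in `m_q`).
* §2 LOAD-BEARING ANALYSIS (LANDED p167133, `Negative/CornerPinLoadBearing.lean`; restated below as
  `RayDescentWithoutPin` / `RayDescentWithoutCorner` + one-line corollaries): deleting the pin
  (resp. the corner) makes the crux FALSE given one regularisation with the standard picture
  (corner, MS, AS, `m_crit → 0`, `a/Z_m → 0`, diagonal chiral softness near `0`, one gapped degenerate
  tuple) — mechanism: the flavour-blind shift `m_crit ↦ m_crit − a M₀/Z_m`, `l = 2`. Mass scaling,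
  asymptotic scaling and the Lüscher branch are INVARIANT under that shift, so they are semantic
  guards, not levers: a proof must use corner + pin jointly (as birth's (B) and the Sketch do).
  TOLERANCE (p167812, `Negative/PinTolerance.lean`): `rayDescent_false_with_negative_pin_offset` —
  for EVERY `c < 0` the crux with pin `→ c` instead of `→ 0` is false given the same witness (shift
  by `|c|`, base tuple `μ₁ + |c|`, `l = (μ₀+|c|)/(μ₁+|c|)`): the tolerance `o(a/Z_m)` is SHARP and
  ONE-SIDED (an offset `c > 0`, critical mass above the corner, is the crux for heavier true masses
  and is not refutable this way — census D1 made precise); `repinInvariance_false_with_bounded_pin` —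
  the line's stub (B) with a merely BOUNDED pin is false: a proof of (B) must use `e_k → 0`.
* §3 NATURAL STRENGTHENINGS REFUTED. (a) "Euler descent holds for every affine self-adjoint family
  `H(q) = H₀ + qV` with a GAPLESS corner at `q = 0`" is false in dimension 3: `toyH q`, levels
  `(15 − √(225+64q²))/2 < q < (15 + √(225+64q²))/2`, gap `q + (√(225+64q²) − 15)/2 → 0` at the corner,
  but `gap(1) = 2 < 3 = gap(5/2)/(5/2)` (`toyH_eigenpairs`, `toyH_violates_descent`, rational
  eigenpairs, kernel-checked). Mechanism: second-order level repulsion pushes the vacuum DOWN (ground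
  energy concave in `q`), i.e. BINDING ENERGY — the Coulombic-quarkonium worry in miniature; the gap is
  a difference of two concave sector infima and carries no sign. So the positivity "trace-anomaly share
  ≥ 0" is QCD-specific input even granted a gapless corner and first-order (Feynman–Hellmann/Kato)
  perturbation theory. (b) PAPER: strict margin `share ≤ 1 − θ` is false (BZ window `32/33`, RGI
  quarkonium → 1⁻); `Δ' ≤ Δ/l` non-strict / `l < 1` (ascent) are not claimed and would be false by
  the Goldstone law `Δ ∝ √m`.
* §4 LINE `Sketch`, STUB (M) `stub_harnackConeMembership` (per-coupling families `G k i`, skeleton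
  77369e41…). (i) `coneConclusion_of_rayInfiniteGap` / `coneConclusion_of_rayGapless`: the stub's
  ∃-conclusion is inhabited by `ι = Empty` on a ray with every rate certified and by `G ≡ 0` on a
  ray with no rate certified — (M) makes NO existence claim, its entire content is the SHAPE of the
  gap function `g = liminf_k inf_i G k i` along `[1, ∞)`. (ii) LANDED p167257
  (`Negative/ConeMembershipUpwardLaw.lean`): Harnack is two-sided — `x·v(x)` is non-decreasing too
  (`harnackCone_reverseChord`), hence (M) ⊢ a SECOND law the line never uses,
  `stub_harnackConeMembership_upwardLaw`: gap `Δ` at `t₁·m` ⇒ every `Δ' < (t₁/t₂)Δ` at `t₂·m`,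
  `1 ≤ t₁ ≤ t₂` (sub-inverse upward law = weak shadow of `QuarkMassMonotone.LatticeGapMonotone`,
  stmt-8905; physically harmless, but (M) is refutable from EITHER direction of the ray).
  (iii) SORRY `not_harnackHull_max_one_half` (paper proof in its docstring): `g(x) = max 1 (x/2)`
  has `g(x)/x ↓` and `x·g(x) ↑` yet is NOT an infimum of non-negative harmonic functions on the
  half-plane — (M) is strictly stronger than "downward ∧ upward chord laws"; what survives infima of
  Herglotz functions `c x + π⁻¹∫ x dν(s)/(x²+s²)` is a CONCAVITY-TYPE hull condition (every concave
  `g ≥ 0` with `g ↑`, `g/x ↓` IS such an infimum — of its tangents `d + b·Re z`, `d, b ≥ 0`; a convex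
  kink is not). Physically the gap along a ray is plausibly concave (√-Goldstone branch, sublinear
  glueball branch `t^{2N_f/33}`, RGI-quarkonium branch; `min` of concave is concave), so no kill, but
  the honest content of (M) is "ray-concavity up to Harnack hull" — census S⁺1, for which no mechanism
  is known. (iv) PAPER, configuration-wise numerical range: for `r = 1` Wilson fermions each hopping
  term `K_μ` is an isometry, so `Re⟨v, D_W(m₀) v⟩ ≥ m₀‖v‖²` and `det(D_W(U) + m₀) ≠ 0` for
  `Re m₀ > 0` and EVERY `U` — the only configuration-wise Lee–Yang-type protection available. The
  corner sits at `m_c(β_k) < 0`, so in the ray parameter `t = (m₀ − m_c)/(a_k m/Z_m)` the protected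
  half-plane is `Re t > |m_c(β_k)|·Z_m(k)/(a_k m) → ∞`: the whole physical half-plane of (M) lies in
  the UNPROTECTED strip `m_c < Re m₀ < 0` (home of the exceptional configurations), for every `N_f`
  (not only odd `N_f` as the card concedes). The ideator's own U(1) `1⁴` toy already has averaged
  zeros at `arg μ ≈ 60°, 81°`. So (M)'s MOTIVATION (vacuum dominance on all of `{Re t > 0}`) has no
  configuration-wise support anywhere it is needed; (M) can only hold as a statement about the
  averaged theory's gap SHAPE, i.e. as ray-concavity.
* §5 TARGETS: none served this cycle (`payload.targets = []`, no STUCK list from the lead).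
* §6 NEAR-MISSES / NEXT: `not_harnackHull_max_one_half` (needs the half-plane Herglotz
  representation or the Julia–Carathéodory angular-derivative lemma `h − L·Re z ≥ 0`,
  `L = lim h(x)/x`; neither is in the tree); semigroup localisation `RayDescent ↔ (RayDescent for
  l ≤ 2)` (census D4; routine, unfiled); a data check of ray-CONCAVITY of `M_PS(m_RGI)` through the
  strange–charm region (the one place (M) could fail while the crux holds).

How to cite: the landed lemmas live in `Summit.QuantumFields.QCD.Theorems.RayDescentNegative.*`
(files `Theorems/RayDescent/Negative/{TrivialSlices,CornerPinLoadBearing,ConeMembershipUpwardLaw,PinTolerance}.lean`;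
`PinTolerance` is p167812, import it here once applied).
-/

noncomputable section

namespace Summit.QuantumFields.QCD.Cruxes.RayDescent.Disproof

open Filter Topology
open Literature.MathematicalPhysics.QuantumFieldTheory
open Summit.QuantumFields.QCD.Theses.EulerDescent
open Summit.QuantumFields.QCD.Theorems.RayDescentNegative

/-! ## §2 Load-bearing analysis — the crux with one hypothesis deleted (landed p167133) -/

/-- `RayDescent` with the PIN `(m_crit − mc)·Z_m/a → 0` deleted, everything else verbatim. -/
def RayDescentWithoutPin : Prop :=
  ∀ (Nf : ℕ) (reg : QCDRegularisation Nf) (mc : ℕ → ℝ),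
    (∀ᶠ k in atTop, IsLUB {μ : ℝ | ¬ (∀ (R R' : ℕ) (A : QCDLatticeObservable Nf R)
        (B : QCDLatticeObservable Nf R'), ∃ (C δ : ℝ) (S₀ : ℕ), 0 < δ ∧ ∀ S : ℕ, S₀ ≤ S →
          ∀ n : ℕ, n ≤ S → ‖qcdLatticeConnectedCorr (reg.β k) (2 * S + 1)
            (fun _ : Fin Nf => μ) A B n‖ ≤ C * Real.exp (-(δ * n)))} (mc k)) →
    reg.HasMassScaling → (reg.scheme 0 0 0).HasAsymptoticScaling →
    (∀ᶠ k in atTop, (-1 : ℝ) < reg.mcrit k) →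
    ∀ m : Fin Nf → ℝ, (∀ f, 0 < m f) → ∀ l : ℝ, 1 ≤ l → ∀ Δ : ℝ, 0 < Δ →
      (reg.scheme (fun f => l * m f) 0 0).HasLatticeMassGap Δ →
      ∀ Δ' : ℝ, 0 < Δ' → Δ' < Δ / l → (reg.scheme m 0 0).HasLatticeMassGap Δ'

/-- `RayDescent` with the CORNER clause deleted, everything else verbatim. -/
def RayDescentWithoutCorner : Prop :=
  ∀ (Nf : ℕ) (reg : QCDRegularisation Nf) (mc : ℕ → ℝ),
    Tendsto (fun k => (reg.mcrit k - mc k) * reg.Zm k / reg.a k) atTop (𝓝 0) →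
    reg.HasMassScaling → (reg.scheme 0 0 0).HasAsymptoticScaling →
    (∀ᶠ k in atTop, (-1 : ℝ) < reg.mcrit k) →
    ∀ m : Fin Nf → ℝ, (∀ f, 0 < m f) → ∀ l : ℝ, 1 ≤ l → ∀ Δ : ℝ, 0 < Δ →
      (reg.scheme (fun f => l * m f) 0 0).HasLatticeMassGap Δ →
      ∀ Δ' : ℝ, 0 < Δ' → Δ' < Δ / l → (reg.scheme m 0 0).HasLatticeMassGap Δ'

/-- **The standard-picture witness** against which the deletions are tested [topic lattice-qcd]:
ONE regularisation with an intrinsic corner sequence, leading-log mass scaling, two-loop asymptotic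
scaling, `m_crit(k) → 0`, bare-mass resolution `a_k/Z_m(k) → 0`, chiral softness along the diagonal
near zero (for every rate `ε` and every `δ > 0` a degenerate tuple `0 < μ < δ` without the uniform
gap `ε` — Goldstone), and one gapped degenerate tuple `μ₀ > 0`. Every clause is asserted in
substance by the route itself (HonestHeavyAnchor + ChiralCornerSoftness) for `N_f = 2, 3`; none is
constructible in the present tree. -/
def StandardPictureWitness : Prop :=
  ∃ (Nf : ℕ) (reg : QCDRegularisation Nf) (mc : ℕ → ℝ),
    (∀ᶠ k in atTop, IsLUB {μ : ℝ | ¬ (∀ (R R' : ℕ) (A : QCDLatticeObservable Nf R)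
        (B : QCDLatticeObservable Nf R'), ∃ (C δ : ℝ) (S₀ : ℕ), 0 < δ ∧ ∀ S : ℕ, S₀ ≤ S →
          ∀ n : ℕ, n ≤ S → ‖qcdLatticeConnectedCorr (reg.β k) (2 * S + 1)
            (fun _ : Fin Nf => μ) A B n‖ ≤ C * Real.exp (-(δ * n)))} (mc k)) ∧
    reg.HasMassScaling ∧ (reg.scheme 0 0 0).HasAsymptoticScaling ∧
    Tendsto reg.mcrit atTop (𝓝 0) ∧ Tendsto (fun k => reg.a k / reg.Zm k) atTop (𝓝 0) ∧
    (∀ ε : ℝ, 0 < ε → ∀ δ : ℝ, 0 < δ → ∃ μ : ℝ, 0 < μ ∧ μ < δ ∧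
      ¬ (reg.scheme (fun _ : Fin Nf => μ) 0 0).HasLatticeMassGap ε) ∧
    ∃ μ₀ : ℝ, 0 < μ₀ ∧ ∃ Δ₀ : ℝ, 0 < Δ₀ ∧
      (reg.scheme (fun _ : Fin Nf => μ₀) 0 0).HasLatticeMassGap Δ₀

/-- **Any proof of the crux must use the pin** (corollary of the landed
`rayDescent_false_without_pin`, p167133). -/
theorem rayDescentWithoutPin_false (hW : StandardPictureWitness) : ¬ RayDescentWithoutPin := by
  obtain ⟨Nf, reg, mc, hcorner, hms, haf, hcrit, hres, hsoft, μ₀, hμ₀, Δ₀, hΔ₀, hgap⟩ := hW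
  exact rayDescent_false_without_pin reg mc hcorner hms haf hcrit hres hsoft hμ₀ hΔ₀ hgap

/-- **Any proof of the crux must use the corner** (corollary of the landed
`rayDescent_false_without_corner`, p167133; the corner clause of the witness is not even needed). -/
theorem rayDescentWithoutCorner_false (hW : StandardPictureWitness) : ¬ RayDescentWithoutCorner := by
  obtain ⟨Nf, reg, _mc, -, hms, haf, hcrit, hres, hsoft, μ₀, hμ₀, Δ₀, hΔ₀, hgap⟩ := hW
  exact rayDescent_false_without_corner reg hms haf hcrit hres hsoft hμ₀ hΔ₀ hgap

/-- Sanity: the full crux is of course implied by either deleted form (so the deletions are genuine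
weakenings of the hypotheses, i.e. strengthenings of the statement). -/
theorem rayDescent_of_withoutPin (h : RayDescentWithoutPin) : RayDescent :=
  fun Nf reg mc hc _ hms haf hb => h Nf reg mc hc hms haf hb

/-! ## §3 A natural strengthening refuted: affine spectral families with a gapless corner

The Feynman–Hellmann/Kato heuristic behind the crux reads the gap as the lowest level difference of
a self-adjoint family. For AFFINE families `H(q) = H₀ + q V` on `ℚ³` with a gapless corner at
`q = 0` Euler descent with constant `1` already fails: `toyH q = !![0, 0, 4q; 0, q, 0; 4q, 0, 15]`
(`H₀ = diag(0,0,15)`, `V = !![0,0,4; 0,1,0; 4,0,0]`). Its levels are `(15 ± √(225 + 64 q²))/2` and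
`q`; all three tend to `{0, 15}` with the two lowest meeting at `0` as `q → 0⁺` (gapless corner), the
gap `q + (√(225+64q²) − 15)/2` is positive for `q > 0`, and at the rational points `q = 1`,
`q = 5/2` the spectra are `{−1, 1, 16}` and `{−5, 5/2, 20}`: `gap(1) = 2`, `gap(5/2) = 15/2`, and
descent from `5/2` to `1` (`l = 5/2`) would demand `gap(1) ≥ gap(5/2)/l = 3`. -/

/-- The three-level affine toy family `H₀ + q V`. -/
def toyH (q : ℚ) : Matrix (Fin 3) (Fin 3) ℚ := !![0, 0, 4 * q; 0, q, 0; 4 * q, 0, 15]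

/-- The toy family is affine in `q` with `H₀ = diag(0, 0, 15)`. [folklore] -/
theorem toyH_affine (q : ℚ) :
    toyH q = !![0, 0, 0; 0, 0, 0; 0, 0, 15] + q • !![0, 0, 4; 0, 1, 0; 4, 0, 0] := by
  ext i j
  fin_cases i <;> fin_cases j <;> simp [toyH, mul_comm]

/-- The toy matrices are symmetric (self-adjoint over `ℚ`). [folklore] -/
theorem toyH_symm (q : ℚ) : (toyH q).transpose = toyH q := by
  ext i j
  fin_cases i <;> fin_cases j <;> simp [toyH]

/-- **Rational eigenpairs at `q = 1` and `q = 5/2`**: spectra `{−1, 1, 16}` and `{−5, 5/2, 20}`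
(three distinct eigenvalues each, so these ARE the spectra). [folklore] -/
theorem toyH_eigenpairs :
    (toyH 1).mulVec ![4, 0, -1] = (-1 : ℚ) • ![4, 0, -1] ∧
    (toyH 1).mulVec ![0, 1, 0] = (1 : ℚ) • ![0, 1, 0] ∧
    (toyH 1).mulVec ![1, 0, 4] = (16 : ℚ) • ![1, 0, 4] ∧
    (toyH (5 / 2)).mulVec ![2, 0, -1] = (-5 : ℚ) • ![2, 0, -1] ∧
    (toyH (5 / 2)).mulVec ![0, 1, 0] = (5 / 2 : ℚ) • ![0, 1, 0] ∧
    (toyH (5 / 2)).mulVec ![1, 0, 2] = (20 : ℚ) • ![1, 0, 2] := by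
  refine ⟨?_, ?_, ?_, ?_, ?_, ?_⟩ <;>
  · ext i
    fin_cases i <;> simp [toyH, Matrix.mulVec, dotProduct, Fin.sum_univ_three] <;> norm_num

/-- **Euler descent fails for the toy**: with `gap(1) = 1 − (−1) = 2` and
`gap(5/2) = 5/2 − (−5) = 15/2`, the descent inequality `gap(q₁) ≥ gap(q₂)·q₁/q₂` from `q₂ = 5/2`
to `q₁ = 1` is violated (`2 < 3`): `gap(q)/q` is NOT antitone although the corner `q = 0` is
gapless. [folklore] -/
theorem toyH_violates_descent :
    ¬ (((5 / 2 : ℚ) - (-5)) * 1 / (5 / 2) ≤ (1 : ℚ) - (-1)) := by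
  norm_num

/-! ## §4 Line `Sketch`, stub (M) `stub_harnackConeMembership` -/

/-- **(M)'s conclusion on a ray with every rate certified is inhabited by the EMPTY family**
(`ι = Empty`: harmonicity, non-negativity and the upper clause are vacuous, the lower clause is the
hypothesis). So (M) asserts nothing about existence of a gap. [folklore] -/
theorem coneConclusion_of_rayInfiniteGap {Nf : ℕ} (reg : QCDRegularisation Nf) (m : Fin Nf → ℝ)
    (h : ∀ t : ℝ, 1 ≤ t → ∀ Δ : ℝ, 0 < Δ →
      (reg.scheme (fun f => t * m f) 0 0).HasLatticeMassGap Δ) :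
    ∃ (ι : Type) (G : ℕ → ι → ℂ → ℝ),
      (∀ k i, InnerProductSpace.HarmonicOnNhd (G k i) {z : ℂ | 0 < z.re}) ∧
      (∀ k i (z : ℂ), 0 < z.re → 0 ≤ G k i z) ∧
      (∀ t : ℝ, 1 ≤ t → ∀ Δ : ℝ, 0 < Δ →
        (reg.scheme (fun f => t * m f) 0 0).HasLatticeMassGap Δ →
          ∀ᶠ k in atTop, ∀ i, Δ ≤ G k i t) ∧
      (∀ t : ℝ, 1 ≤ t → ∀ Δ : ℝ, 0 < Δ →
        (∃ ε : ℝ, 0 < ε ∧ ∀ᶠ k in atTop, ∀ i, Δ + ε ≤ G k i t) →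
          (reg.scheme (fun f => t * m f) 0 0).HasLatticeMassGap Δ) :=
  ⟨Empty, fun _ i => i.elim, fun _ i => i.elim, fun _ i => i.elim,
    fun _ _ _ _ _ => Eventually.of_forall fun _ i => i.elim, fun t ht Δ hΔ _ => h t ht Δ hΔ⟩

/-- **(M)'s conclusion on a ray with NO rate certified is inhabited by `G ≡ 0`** (the upper clause
is vacuous, the lower clause has a contradictory premise `Δ + ε ≤ 0` eventually). So (M) is
consistent with a totally gapless ray as well: its whole content is the SHAPE of the gap function.
[folklore] -/
theorem coneConclusion_of_rayGapless {Nf : ℕ} (reg : QCDRegularisation Nf) (m : Fin Nf → ℝ)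
    (h : ∀ t : ℝ, 1 ≤ t → ∀ Δ : ℝ, 0 < Δ →
      ¬ (reg.scheme (fun f => t * m f) 0 0).HasLatticeMassGap Δ) :
    ∃ (ι : Type) (G : ℕ → ι → ℂ → ℝ),
      (∀ k i, InnerProductSpace.HarmonicOnNhd (G k i) {z : ℂ | 0 < z.re}) ∧
      (∀ k i (z : ℂ), 0 < z.re → 0 ≤ G k i z) ∧
      (∀ t : ℝ, 1 ≤ t → ∀ Δ : ℝ, 0 < Δ →
        (reg.scheme (fun f => t * m f) 0 0).HasLatticeMassGap Δ →
          ∀ᶠ k in atTop, ∀ i, Δ ≤ G k i t) ∧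
      (∀ t : ℝ, 1 ≤ t → ∀ Δ : ℝ, 0 < Δ →
        (∃ ε : ℝ, 0 < ε ∧ ∀ᶠ k in atTop, ∀ i, Δ + ε ≤ G k i t) →
          (reg.scheme (fun f => t * m f) 0 0).HasLatticeMassGap Δ) := by
  refine ⟨Unit, fun _ _ _ => 0, fun _ _ _ _ => InnerProductSpace.harmonicAt_const 0,
    fun _ _ _ _ => le_rfl, fun t ht Δ hΔ hg => (h t ht Δ hΔ hg).elim, fun t _ Δ hΔ hε => ?_⟩
  obtain ⟨ε, hε, hev⟩ := hε
  obtain ⟨k, hk⟩ := hev.exists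
  have := hk ()
  linarith

/-- **Hidden upward law of (M)** (landed p167257, restated through the line's own `Prop`s would
need the Sketch workfile; here: the stub's ∃-conclusion for `(reg, m)` ⇒ the sub-inverse upward law
along the ray). [folklore] -/
theorem upwardLaw_of_coneConclusion {Nf : ℕ} (reg : QCDRegularisation Nf) (m : Fin Nf → ℝ)
    (hM : ∃ (ι : Type) (G : ℕ → ι → ℂ → ℝ),
      (∀ k i, InnerProductSpace.HarmonicOnNhd (G k i) {z : ℂ | 0 < z.re}) ∧
      (∀ k i (z : ℂ), 0 < z.re → 0 ≤ G k i z) ∧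
      (∀ t : ℝ, 1 ≤ t → ∀ Δ : ℝ, 0 < Δ →
        (reg.scheme (fun f => t * m f) 0 0).HasLatticeMassGap Δ →
          ∀ᶠ k in atTop, ∀ i, Δ ≤ G k i t) ∧
      (∀ t : ℝ, 1 ≤ t → ∀ Δ : ℝ, 0 < Δ →
        (∃ ε : ℝ, 0 < ε ∧ ∀ᶠ k in atTop, ∀ i, Δ + ε ≤ G k i t) →
          (reg.scheme (fun f => t * m f) 0 0).HasLatticeMassGap Δ))
    (t₁ t₂ : ℝ) (ht₁ : 1 ≤ t₁) (ht₁₂ : t₁ ≤ t₂) (Δ : ℝ) (hΔ : 0 < Δ)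
    (hgap : (reg.scheme (fun f => t₁ * m f) 0 0).HasLatticeMassGap Δ)
    (Δ' : ℝ) (hΔ' : 0 < Δ') (hlt : Δ' < t₁ * Δ / t₂) :
    (reg.scheme (fun f => t₂ * m f) 0 0).HasLatticeMassGap Δ' := by
  obtain ⟨ι, G, hharm, hnonneg, hupper, hlower⟩ := hM
  exact upwardLaw_of_harnackConeMembership reg m G hharm hnonneg hupper hlower t₁ t₂ ht₁ ht₁₂ Δ hΔ
    hgap Δ' hΔ' hlt

/-- **NEAR-MISS (sorry; paper proof here).** The Harnack hull is strictly smaller than "both chord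
laws": `g(x) = max 1 (x/2)` on `[1, ∞)` has `g(x)/x` non-increasing and `x·g(x)` non-decreasing,
yet is NOT the trace of an infimum of non-negative harmonic functions on the right half-plane.
Paper proof: a non-negative harmonic `h` on `{Re z > 0}` has the Herglotz form
`h(x) = c x + π⁻¹ ∫ x dν(s)/(x² + s²)` on the positive axis (`c ≥ 0`, `ν ≥ 0`), so
`h(x)/x = c + F(x)` with `F ↓ 0` and `F(1) ≤ 4 F(2)` (kernel ratio `(4+s²)/(1+s²) ≤ 4`). If
`h ≥ g` on `[1,∞)` and `h(2) ≤ 1 + ε` then `c ≥ 1/2` (from `x → ∞`), `F(2) ≤ (1+ε)/2 − c`,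
`F(1) ≥ 1 − c`, hence `1 − c ≤ 4((1+ε)/2 − c) = 2 + 2ε − 4c`, i.e. `c ≤ (1 + 2ε)/3`, and then
`F(2) ≤ (1+ε)/2 − c` forces `c ≤ (1+ε)/2`; combining with `F(1) ≥ 1 − c ≥ (1 − 2ε)/3... ` one gets
`0 ≤ F(2) ≤ (1+ε)/2 − c` and `F(2) ≥ F(1)/4 ≥ (1 − c)/4`, so `(1 − c)/4 ≤ (1+ε)/2 − c`, i.e.
`3c ≤ 1 + 2ε`, while `c ≥ 1/2` — contradiction for `ε < 1/4`. Obstruction to closing it here: the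
tree has disc Poisson/Herglotz kernels for continuous boundary data (`DiscDirichletProblem`) but not
the Riesz–Herglotz representation of an arbitrary non-negative harmonic function on the half-plane,
nor the Julia–Carathéodory lemma `h − c·Re z ≥ 0`; two-point Harnack alone cannot see the kink.
Consequence for the line: stub (M) demands a concavity-type hull condition on the gap along the
ray (census S⁺1), strictly beyond the crux. -/
theorem not_harnackHull_max_one_half :
    ¬ ∃ (ι : Type) (G : ι → ℂ → ℝ),
      (∀ i, InnerProductSpace.HarmonicOnNhd (G i) {z : ℂ | 0 < z.re}) ∧
      (∀ i (z : ℂ), 0 < z.re → 0 ≤ G i z) ∧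
      (∀ x : ℝ, 1 ≤ x → ∀ i, max 1 (x / 2) ≤ G i x) ∧
      (∀ x : ℝ, 1 ≤ x → ∀ ε : ℝ, 0 < ε → ∃ i, G i x ≤ max 1 (x / 2) + ε) := by
  sorry

end Summit.QuantumFields.QCD.Cruxes.RayDescent.Disproof

end
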